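import Mathlib
import Literature.RingTheory.CohomologyAnnihilator.AnnihilationOfCohomology
import Literature.RingTheory.CohomologyAnnihilator.RegularLocalRing
import Literature.AlgebraicGeometry.Resolution.AffineDomainDimension
import Literature.AlgebraicGeometry.Resolution.NormalSurfaceSingularLocus
import Summits.ResolutionOfSingularities.ResolutionOfSingularities.Theorems.SyzygyFlatteningHigherRankTerminationLocAt
import Summits.ResolutionOfSingularities.ResolutionOfSingularities.Theorems.SyzygyFlatteningHigherRankTerminationTowerStageBasic
import Summits.ResolutionOfSingularities.ResolutionOfSingularities.Theorems.SyzygyFlatteningHigherRankTerminationNrmLocAt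
import Summits.ResolutionOfSingularities.ResolutionOfSingularities.Theorems.HomologicalConductorPersistenceLocalisation
import Summits.ResolutionOfSingularities.ResolutionOfSingularities.Theorems.HomologicalConductorNoZenoTowerNoetherian
import Summits.ResolutionOfSingularities.ResolutionOfSingularities.Theorems.HomologicalConductorNoZenoDominanceInvariance
import HarnessLib

/-!
# Crux `StrictDrop` (stmt-ResolutionOfSingularities-16485), line `birth` — stub `stub_stationary_regular`

Route `ResolutionOfSingularities/HomologicalConductor`, stub SB ("a frozen stage is regular") of
the line `birth`: along the canonical normalised `ca`-tower `T₀ = loc A`,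
`T_(m+1) = loc (nrm (chart T_m))` of a finitely generated `A ⊆ O ⊆ K = Frac A` (`O` a valuation
ring of `K ⊇ k`; `loc` = localise at the centre of `O` inside `K`, `chart` = the `O`-chart of the
blow-up of the Iyengar–Takahashi cohomology annihilator `ca`, `nrm` = normalise inside `K`), a
FROZEN stage `T_(n+1) = T_n` is a regular local ring — GIVEN Iyengar–Takahashi 2014, Thm. 5.4
(`V(ca R) = Sing R` for `R` essentially of finite type over a field), which enters as the first
hypothesis (the tree's named fact `Literature.RingTheory.CohomologyAnnihilator.singEqVCa_essFiniteType`).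
Every stage is assumed to have the tower `Shape` (it is `loc B` of a finitely generated `B ≤ T_m`,
noetherian, `⊆ O`, local at the centre), the neighbouring stub `stub_towerShape`, a hypothesis here.

## Proof (`isRegularLocalRing_of_frozen`)

Write `T = T_n = locAt O B` (the route's `loc` is verbatim `SyzygyFlattening.locAt`).
* Frozen ⇒ closed: `T ≤ chart T ≤ nrm (chart T) ≤ loc (nrm (chart T)) = T_(n+1) = T`, so the chart
  generators `c * x⁻¹` (`c, x ∈ ca T`, `x ≠ 0` of minimal value) lie in `T`, and every element of
  `K` integral over `T` lies in `T`; as `A ≤ T`, `Frac T = K` and `T` is integrally closed.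
* Thm. 5.4 applies to `T`, a localisation of the finitely generated `B` (`isLocalization_locAt`,
  `dim B < ∞` by `exists_ringKrullDim_eq_and_trdeg_eq`): for every prime `𝔮` of `T`,
  `ca T ⊆ 𝔮 → T_𝔮` is singular (`not_isRegularLocalRing_of_ca_le`).
* In the normal noetherian domain `T` the localisation at a prime of height `≤ 1` is regular
  (`isRegularLocalRing_atPrime_of_height_le_one`: normal of dimension `≤ 1`, tree
  `isRegularLocalRing_of_isIntegrallyClosed_of_ringKrullDim_le_one`). At `𝔮 = ⊥`: `ca T ≠ 0`.
* If `T` were singular, `ca T ≠ T` (`isRegularLocalRing_of_cohomologyAnnihilator_eq_top`); a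
  nonzero `x₀ ∈ ca T` of minimal value exists (`NoZeno.Birth.di_exists_admissible`), and by
  frozenness `c * x₀⁻¹ ∈ T` for all `c ∈ ca T`, i.e. `ca T ⊆ (x₀)`; a minimal prime `𝔮` of `(x₀)`
  has height `≤ 1` (Krull's Hauptidealsatz) and contains `ca T` — so `T_𝔮` is both singular
  (Thm. 5.4) and regular (normality): contradiction.

The statement is the registered stub with the route's `let`-bound tower inlined verbatim
(definitionally equal, `Iff.rfl`, to `Sig.stub_stationary_regular` of the line skeleton
`Cruxes/StrictDrop/Lines/birth.lean`).

References: S. B. Iyengar, R. Takahashi, *Annihilation of cohomology and strong generation of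
module categories*, IMRN 2016, Thm. 5.4 [`IyengarTakahashi2014`]; H. Matsumura, *Commutative Ring
Theory*, Thm. 11.2, 11.5 [`Matsumura1987`].
-/

noncomputable section

-- single-problem summit: the doubled namespace component is forced
set_option linter.dupNamespace false

namespace Summit.ResolutionOfSingularities.ResolutionOfSingularities.Theorems.StrictDrop.Birth.StationaryRegular

open Literature.RingTheory.CohomologyAnnihilator IsLocalRing
open Literature.AlgebraicGeometry.Resolution
  (exists_ringKrullDim_eq_and_trdeg_eq isRegularLocalRing_of_isIntegrallyClosed_of_ringKrullDim_le_one
    isFractionRing_subalgebra_of_le)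
open Summit.ResolutionOfSingularities.ResolutionOfSingularities.Theorems.SyzygyFlattening
  (locAt self_le_locAt self_le_nrm isLocalRing_locAt isIntegral_of_le)
open Summit.ResolutionOfSingularities.ResolutionOfSingularities.Theorems.HomologicalConductor.PersistenceLocalisation
  (isLocalization_locAt)
open Summit.ResolutionOfSingularities.ResolutionOfSingularities.Theorems.NoZeno.Birth
  (tn_coe_mem_ca_iff ca_subset di_exists_admissible)

variable {k K : Type} [Field k] [Field K] [Algebra k K]

/-! ## Regular points of height `≤ 1` in a normal noetherian domain -/

/-- In a normal noetherian domain `R`, the localisation at a prime `𝔮` of height `≤ 1` is a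
regular local ring: `R_𝔮` is a normal noetherian local domain (`isIntegrallyClosed_of_isLocalization`)
of dimension `height 𝔮 ≤ 1` (`IsLocalization.AtPrime.ringKrullDim_eq_height`), i.e. a field or a
discrete valuation ring (Serre's `R₁` for normal rings). [cite: Matsumura1987, Thm. 11.2 and Thm. 11.5] -/
theorem isRegularLocalRing_atPrime_of_height_le_one {R : Type*} [CommRing R] [IsDomain R]
    [IsNoetherianRing R] [IsIntegrallyClosed R] (𝔮 : Ideal R) [𝔮.IsPrime] (h : 𝔮.height ≤ 1) :
    IsRegularLocalRing (Localization.AtPrime 𝔮) := by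
  -- adapted from `SyzygyFlattening.stub_R1_of_normal` (Theorems/SyzygyFlatteningRankOneTerminationR1OfNormal)
  haveI : IsIntegrallyClosed (Localization.AtPrime 𝔮) :=
    isIntegrallyClosed_of_isLocalization (Localization.AtPrime 𝔮) 𝔮.primeCompl
      𝔮.primeCompl_le_nonZeroDivisors
  refine isRegularLocalRing_of_isIntegrallyClosed_of_ringKrullDim_le_one (Localization.AtPrime 𝔮) ?_
  rw [IsLocalization.AtPrime.ringKrullDim_eq_height 𝔮 (Localization.AtPrime 𝔮)]
  exact_mod_cast h

/-! ## A frozen localised model is regular (given Iyengar–Takahashi, Thm. 5.4) -/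

/-- **A frozen stage is regular.** Let `T = locAt O B ⊆ O` be the localisation at the centre of
`O` of a finitely generated `k`-subalgebra `B` of `K`, noetherian with `Frac T = K`, and FROZEN
under the route's operator: the `ca`-chart generators `c * x⁻¹` (`c, x ∈ ca T`, `x ≠ 0` of minimal
value) lie in `T` (`chart O T ≤ T`) and `T` is integrally closed in `K`. Then, granted
Iyengar–Takahashi 2014 Thm. 5.4 (`V(ca T) = Sing T` for the localisation `T` of `B`), `T` is a
regular local ring: otherwise `0 ≠ ca T ≠ T` is principal by frozenness (generated by an
annihilator of minimal value), a minimal prime `𝔮` over it has height `≤ 1` (Krull), and `T_𝔮` is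
regular by normality but singular by Thm. 5.4. [cite: IyengarTakahashi2014, Thm. 5.4] -/
theorem isRegularLocalRing_of_frozen (h54 : singEqVCa_essFiniteType.{0}) (O : ValuationSubring K)
    (B T : Subalgebra k K) (hBfg : B.FG) (hT : locAt O B = T) (hTO : T.toSubring ≤ O.toSubring)
    (hfracT : IsFractionRing ↥T K) (hNoeth : IsNoetherianRing ↥T)
    (hchart : NoZeno.Birth.chart O T ≤ T) (hint : ∀ y : K, IsIntegral ↥T y → y ∈ T) :
    IsRegularLocalRing ↥T := by
  subst hT
  haveI := hfracT
  haveI := hNoeth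
  have hBO : B.toSubring ≤ O.toSubring := fun x hx => hTO (self_le_locAt O B hx)
  haveI : IsLocalRing ↥(locAt O B) := isLocalRing_locAt O B hBO
  haveI : IsIntegrallyClosed ↥(locAt O B) :=
    (isIntegrallyClosed_iff K).mpr fun hy => ⟨⟨_, hint _ hy⟩, rfl⟩
  -- Theorem 5.4 for `locAt O B`, a localisation of the finitely generated `k`-algebra `B`
  letI : Algebra ↥B ↥(locAt O B) := (Subalgebra.inclusion (self_le_locAt O B)).toRingHom.toAlgebra
  have hBft : Algebra.FiniteType k ↥B := B.fg_iff_finiteType.mp hBfg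
  haveI := hBft
  obtain ⟨d, hd, -⟩ := exists_ringKrullDim_eq_and_trdeg_eq k ↥B
  have h54' : ∀ (𝔮 : Ideal ↥(locAt O B)) [𝔮.IsPrime],
      cohomologyAnnihilator ↥(locAt O B) ≤ 𝔮 → ¬ IsRegularLocalRing (Localization.AtPrime 𝔮) := by
    intro 𝔮 _ hle
    refine not_isRegularLocalRing_of_ca_le h54 hBft hd _ ↥(locAt O B)
      (isLocalization_locAt O B hBO) 𝔮 ?_
    rwa [ca_eq_cohomologyAnnihilator]
  by_contra hreg
  have hItop : cohomologyAnnihilator ↥(locAt O B) ≠ ⊤ := fun h =>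
    hreg (isRegularLocalRing_of_cohomologyAnnihilator_eq_top h)
  -- `ca ≠ 0`: the localisation at the prime `⊥` (the fraction field) is regular
  have hIbot : cohomologyAnnihilator ↥(locAt O B) ≠ ⊥ := by
    intro h
    refine h54' ⊥ h.le (isRegularLocalRing_atPrime_of_height_le_one ⊥ ?_)
    rw [Ideal.height_bot]
    exact zero_le
  -- an annihilator `x₀ ≠ 0` of minimal value; by frozenness `ca ⊆ (x₀)`
  obtain ⟨z, hzI, hz0⟩ := Submodule.exists_mem_ne_zero_of_ne_bot hIbot
  have hz0' : (z : K) ≠ 0 := fun h => hz0 (ZeroMemClass.coe_eq_zero.mp h)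
  obtain ⟨x₀, hx₀ca, hx₀0, hadm⟩ := di_exists_admissible O (locAt O B) (fun b hb => hTO hb)
    ((tn_coe_mem_ca_iff (locAt O B) z).mpr hzI) hz0'
  have hx₀I : (⟨x₀, ca_subset _ hx₀ca⟩ : ↥(locAt O B)) ∈ cohomologyAnnihilator ↥(locAt O B) :=
    (tn_coe_mem_ca_iff (locAt O B) _).mp hx₀ca
  have hIle : cohomologyAnnihilator ↥(locAt O B) ≤ Ideal.span {⟨x₀, ca_subset _ hx₀ca⟩} := by
    intro c hc
    have hq : (c : K) * x₀⁻¹ ∈ locAt O B :=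
      hchart (Algebra.subset_adjoin (Or.inr
        ⟨(c : K), (tn_coe_mem_ca_iff (locAt O B) c).mpr hc, x₀, hx₀ca, hx₀0, hadm, rfl⟩))
    refine Ideal.mem_span_singleton'.mpr ⟨⟨_, hq⟩, Subtype.ext ?_⟩
    change (c : K) * x₀⁻¹ * x₀ = c
    rw [inv_mul_cancel_right₀ hx₀0]
  -- a minimal prime over `(x₀)` has height `≤ 1` (Krull), contains `ca`, yet is a regular point
  obtain ⟨𝔮, h𝔮⟩ := (Ideal.span {(⟨x₀, ca_subset _ hx₀ca⟩ : ↥(locAt O B))}).nonempty_minimalPrimes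
    (ne_top_of_le_ne_top hItop ((Ideal.span_singleton_le_iff_mem _).mpr hx₀I))
  haveI : 𝔮.IsPrime := h𝔮.1.1
  exact h54' 𝔮 (hIle.trans h𝔮.1.2) (isRegularLocalRing_atPrime_of_height_le_one 𝔮
    (Ideal.height_le_one_of_isPrincipal_of_mem_minimalPrimes _ 𝔮 h𝔮))

/-! ## The stub, in the registered (inlined, `let`-bound) form -/

/-- **Stub `stub_stationary_regular` (SB) of line `birth` of the crux `StrictDrop`.** Granted
Iyengar–Takahashi 2014, Thm. 5.4 (`V(ca R) = Sing R` for localisations `R` of finitely generated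
algebras over a field — the first hypothesis), a frozen stage `T_(n+1) = T_n` of the canonical
normalised `ca`-tower of `A ⊆ O ⊆ K = Frac A`, all of whose stages have the tower `Shape`, is a
regular local ring: `T_n = loc B` is normal with `Frac T_n = K` and contains its chart generators
(frozenness), so a singular `T_n` would have `0 ≠ ca(T_n) ⊆ (x₀) ≠ T_n` for an annihilator `x₀` of
minimal value, and the localisation at a minimal prime of `(x₀)` (height `≤ 1`, Krull) would be
regular by normality and singular by Thm. 5.4 (`isRegularLocalRing_of_frozen`).
[cite: IyengarTakahashi2014, Thm. 5.4] -/
theorem stub_stationary_regular : Literature.RingTheory.CohomologyAnnihilator.singEqVCa_essFiniteType.{0} → ∀ p : ℕ, p.Prime → ∀ (k K : Type) [Field k] [CharP k p] [Field K] [Algebra k K] (O : ValuationSubring K) (A : Subalgebra k K), (∀ c : k, algebraMap k K c ∈ O) → A.FG → IsFractionRing ↥A K → A.toSubring ≤ O.toSubring → let ca : Subalgebra k K → Set K := fun A => {x : K | ∃ hx : x ∈ A, ∃ n : ℕ, ∀ i : ℕ, n ≤ i → ∀ (M N : ModuleCat.{0} ↥A), Module.Finite ↥A M → Module.Finite ↥A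 N → ∀ e : CategoryTheory.Abelian.Ext.{0} M N i, (⟨x, hx⟩ : ↥A) • e = 0}; let loc : Subalgebra k K → Subalgebra k K := fun A => Algebra.adjoin k {y : K | ∃ a ∈ A, ∃ s ∈ A, s⁻¹ ∈ O ∧ y = a * s⁻¹}; let chart : Subalgebra k K → Subalgebra k K := fun A => Algebra.adjoin k ((A : Set K) ∪ {y : K | ∃ c ∈ ca A, ∃ x ∈ ca A, x ≠ 0 ∧ (∀ c' ∈ ca A, c' * x⁻¹ ∈ O) ∧ y = c * x⁻¹}); let nrm : Subalgebra k K → Subalgebra k K := fun B => Algebra.adjoin k {y : K | IsIntegral ↥B y}; let tower : Subalgebra k K → ℕ → Subalgebra k K := fun A m => @Nat.rec (fun _ => Subalgebra k K) (loc A) (fun _ B => loc (nrm (chart B))) m; let Shape : Subalgebra k K → Prop := fun T => (∃ B : Subalgebra k K, B.FG ∧ B ≤ T ∧ loc B = T ∧ ∀ t ∈ T, ∃ b ∈ B, ∃ s ∈ B, s⁻¹ ∈ O ∧ t = b * s⁻¹) ∧ IsNoetherianRing ↥T ∧ T.toSubring ≤ O.toSubring ∧ ∀ s ∈ T, s⁻¹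 ∈ O → s⁻¹ ∈ T; (∀ m : ℕ, Shape (tower A m)) → ∀ n : ℕ, tower A (n + 1) = tower A n → IsRegularLocalRing ↥(tower A n) := by
  intro h54 p _ k K _ _ _ _ O A _ _ hfrac _ ca loc chart nrm tower Shape hShape n hstat
  obtain ⟨⟨B, hBfg, -, hlocB, -⟩, hNoeth, hTO, -⟩ := hShape n
  -- every stage contains `A`, so `Frac (tower A n) = K`
  have hAT : ∀ m : ℕ, A ≤ tower A m := by
    intro m
    induction m with
    | zero => exact self_le_locAt O A
    | succ m ih =>
      refine ih.trans fun y hy => ?_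
      have hy₁ : y ∈ chart (tower A m) := Algebra.subset_adjoin (Or.inl hy)
      have hy₂ : y ∈ nrm (chart (tower A m)) := self_le_nrm (chart (tower A m)) hy₁
      exact self_le_locAt O (nrm (chart (tower A m))) hy₂
  haveI := hfrac
  have hfracT : IsFractionRing ↥(tower A n) K :=
    isFractionRing_subalgebra_of_le A (tower A n) (hAT n)
  -- frozen: `T ≤ chart T ≤ nrm (chart T) ≤ loc (nrm (chart T)) = T`
  have hTc : tower A n ≤ chart (tower A n) := fun y hy => Algebra.subset_adjoin (Or.inl hy)
  have hcT : chart (tower A n) ≤ tower A n := by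
    intro y hy
    have h₁ : y ∈ tower A (n + 1) :=
      self_le_locAt O (nrm (chart (tower A n))) (self_le_nrm (chart (tower A n)) hy)
    rwa [hstat] at h₁
  have hint : ∀ y : K, IsIntegral ↥(tower A n) y → y ∈ tower A n := by
    intro y hy
    have h₁ : y ∈ nrm (chart (tower A n)) := Algebra.subset_adjoin (isIntegral_of_le hTc hy)
    have h₂ : y ∈ tower A (n + 1) := self_le_locAt O (nrm (chart (tower A n))) h₁
    rwa [hstat] at h₂
  exact isRegularLocalRing_of_frozen h54 O B (tower A n) hBfg hlocB hTO hfracT hNoeth hcT hint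

end Summit.ResolutionOfSingularities.ResolutionOfSingularities.Theorems.StrictDrop.Birth.StationaryRegular

end
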